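import Mathlib
import Summits.AnomalousDissipation.AnomalousDissipation.Theorems.DyadicWallCascadeHalfSpaceHierarchyFluxQuadruplesPerOctave

/-!
# Energy flux per octave (tool stub of line `Sketch`, crux `DyadicWallCascade.HalfSpaceHierarchy`)

Statement (`stub_energyFluxPerOctave`, item stmt-AnomalousDissipation-18627, ideator-1 sketch
`FluxPerAreaDyadic`).  Let `V : ℝ³ → ℝ³` and `Q : ℝ³ → ℝ` be of degree `0` under the dilation
`X ↦ 2X` on the open half-space `{z > 0}` (`V (2X) = V X` and `Q (2X) = Q X` whenever `0 < X 2`), and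
let `F = ∫_{[0,1]²} V₃ (‖V‖² / 2 + Q)` be the energy flux through the unit square at height `1`.  Then
the energy flux through the dilated square `[0,2]²` at height `2` is `4F`:
`∫_{[0,2]²} V₃ (‖V‖² / 2 + Q) (x, y, 2) = 4 F`.

Proof.  Pure bookkeeping, no PDE.  By the dilation hypothesis applied at the point
`(x/2, y/2, 1)` (third coordinate `1 > 0`) and `(x, y, 2) = 2 • (x/2, y/2, 1)`, the integrand at height
`2` is `g (2⁻¹ • q)` with `g p := V₃ (p, 1) (‖V (p, 1)‖² / 2 + Q (p, 1))`.  The planar change of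
variables `q ↦ 2⁻¹ • q` on the dilated square
(`setIntegral_dilatedSquare_comp_half_smul`, sibling file `…FluxQuadruplesPerOctave`, valid for every
`g` without integrability) gives `∫_{[0,2]²} g (2⁻¹ • q) = 4 ∫_{[0,1]²} g = 4 F`.

Source: folklore planar change of variables; ideator-1 sketch `FluxPerAreaDyadic`.
-/

set_option linter.dupNamespace false

open MeasureTheory

noncomputable section

namespace Summit.AnomalousDissipation.AnomalousDissipation.Theorems.HalfSpaceHierarchy

/-- A point of the plane `z = 2` is the dilate by `2` of a point of the plane `z = 1`:
`(x, y, 2) = 2 • (x/2, y/2, 1)` in `EuclideanSpace ℝ (Fin 3)`. [folklore] -/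
theorem energyFlux_euclid3_two_eq_two_smul_one (x y : ℝ) :
    (!₂[x, y, (2 : ℝ)] : EuclideanSpace ℝ (Fin 3)) =
      (2 : ℝ) • !₂[(2 : ℝ)⁻¹ * x, (2 : ℝ)⁻¹ * y, (1 : ℝ)] := by
  ext i
  fin_cases i <;> simp

/-- **Energy flux per octave** (ideator-1 sketch `FluxPerAreaDyadic`).  For `V : ℝ³ → ℝ³`,
`Q : ℝ³ → ℝ` of degree `0` under `X ↦ 2X` on the open half-space `{z > 0}`, if the energy flux
`∫_{[0,1]²} V₃ (‖V‖² / 2 + Q)` at height `1` equals `F`, then the energy flux through the dilated square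
`[0,2]²` at height `2` equals `4 F` (planar change of variables `q ↦ 2q` plus dilation invariance). -/
theorem stub_energyFluxPerOctave :
    ∀ (V : EuclideanSpace ℝ (Fin 3) → EuclideanSpace ℝ (Fin 3)) (Q : EuclideanSpace ℝ (Fin 3) → ℝ) (F : ℝ),
      (∀ X : EuclideanSpace ℝ (Fin 3), 0 < X 2 → V ((2 : ℝ) • X) = V X ∧ Q ((2 : ℝ) • X) = Q X) →
      (∫ q in Set.Icc (0 : ℝ) 1 ×ˢ Set.Icc (0 : ℝ) 1,
          (V !₂[q.1, q.2, (1 : ℝ)]) 2 * (‖V !₂[q.1, q.2, (1 : ℝ)]‖ ^ 2 / 2 + Q !₂[q.1, q.2, (1 : ℝ)]) = F) →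
      (∫ q in Set.Icc (0 : ℝ) 2 ×ˢ Set.Icc (0 : ℝ) 2,
          (V !₂[q.1, q.2, (2 : ℝ)]) 2 * (‖V !₂[q.1, q.2, (2 : ℝ)]‖ ^ 2 / 2 + Q !₂[q.1, q.2, (2 : ℝ)])) = 4 * F := by
  intro V Q F hVQ hF
  set g : ℝ × ℝ → ℝ := fun p =>
    (V !₂[p.1, p.2, (1 : ℝ)]) 2 * (‖V !₂[p.1, p.2, (1 : ℝ)]‖ ^ 2 / 2 + Q !₂[p.1, p.2, (1 : ℝ)]) with hg
  have h1 : ∀ q : ℝ × ℝ,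
      (V !₂[q.1, q.2, (2 : ℝ)]) 2 * (‖V !₂[q.1, q.2, (2 : ℝ)]‖ ^ 2 / 2 + Q !₂[q.1, q.2, (2 : ℝ)]) =
        g ((2 : ℝ)⁻¹ • q) := by
    intro q
    have hpos : 0 < (!₂[(2 : ℝ)⁻¹ * q.1, (2 : ℝ)⁻¹ * q.2, (1 : ℝ)] : EuclideanSpace ℝ (Fin 3)) 2 := by
      simp
    rw [energyFlux_euclid3_two_eq_two_smul_one, (hVQ _ hpos).1, (hVQ _ hpos).2]
    rfl
  have h3 := setIntegral_dilatedSquare_comp_half_smul g 1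
  rw [mul_one] at h3
  simp_rw [h1]
  rw [h3, hF]

end Summit.AnomalousDissipation.AnomalousDissipation.Theorems.HalfSpaceHierarchy
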